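import Mathlib.MeasureTheory.Integral.DivergenceTheorem
import Mathlib.Analysis.SpecialFunctions.Complex.Arg
import Literature.Analysis.FluidPDE.ChenHouContinuationProofs
import Literature.Analysis.FluidPDE.AxisymmetricVorticityTransport
import HarnessLib

/-!
# The flux of a tangential periodic field out of a period cell of the cylinder vanishes

Topic `Literature/Analysis/FluidPDE`. Calculus tool for the energy method in the periodic
cylinder `{r ≤ 1} × ℝ/Lℤ` (uniqueness of classical Euler flows, Kato–Lai 1984 Thm I): for a
vector field `G` which is `C¹` on the closed cylinder `{r ≤ 1}`, `L`-periodic in `z` and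
tangential on the wall (`G · e_r = 0` on `{r = 1}`), the integral of `div G` over the period cell
`{r ≤ 1, 0 ≤ z ≤ L}` vanishes. We prove it **in cylindrical coordinates**, where the cell is the
box `[0,1] × [−π,π] × [0,L]` and no change-of-variables theorem is needed downstream (the energy
of the uniqueness proof is likewise written as a box integral with the Jacobian weight `r`):

`∫_{p ∈ [0,1]×[−π,π]×[0,L]} p₀ · (div G)(Φ p) dp = 0`, `Φ(r, θ, z) = r e_r(θ) + z e_z`
(`setIntegral_mul_divergence_cylCoord_eq_zero`).

Proof: with the flux components `f₀ = r ⟪G∘Φ, e_r⟫`, `f₁ = ⟪G∘Φ, e_θ⟫`, `f₂ = r ⟪G∘Φ, e_z⟫` one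
has `∂_r f₀ + ∂_θ f₁ + ∂_z f₂ = r (div G)∘Φ` on the open box (chain rule; the divergence is the
trace in the rotating orthonormal frame `(e_r, e_θ, e_z) = R_θ(e₀, e₁, e₂)`), and Mathlib's
divergence theorem on boxes (`MeasureTheory.integral_divergence_of_hasFDerivAt_off_countable'`)
turns the integral into face terms, all of which vanish: `f₀ = ⟪G, e_r⟫ = 0` on `r = 1` (slip) and
`f₀ = 0` on `r = 0`; the `θ`-faces `θ = ±π` carry the same integrand; the `z`-faces `z = 0, L`
carry the same integrand by periodicity.

## Main definitions and statements (all proved)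

* `frameR θ`, `frameTheta θ` (`e_r(θ)`, `e_θ(θ)`), `frameBasis θ` (the rotating orthonormal
  frame), `cylCoord` (`Φ`), `cylBoxLo`, `cylBoxHi L` (the parameter box), `cylFlux G`.
* `sum_fderiv_cylFlux` : `Σᵢ ∂ᵢ fᵢ (p) = p₀ (div G)(Φ p)`.
* `setIntegral_mul_divergence_cylCoord_eq_zero` : the flux identity above.

Mathlib has the divergence theorem only for boxes (`DivergenceTheorem.lean`) and the planar polar
change of variables (`integral_comp_polarCoord_symm`), no divergence theorem on balls/cylinders;
the tree has whole-space integration by parts (`WholeSpaceIBP`, `EnergyUniqueness`) only.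
-/

noncomputable section

open MeasureTheory Set Function Filter Topology TopologicalSpace WithLp
open scoped ContDiff NNReal ENNReal InnerProductSpace RealInnerProductSpace

namespace Literature.Analysis.FluidPDE

/-- Local notation for physical space `ℝ³ = EuclideanSpace ℝ (Fin 3)`. -/
local notation "ℝ³" => EuclideanSpace ℝ (Fin 3)

/-! ### The rotating frame -/

/-- The radial unit vector at angle `θ`: `e_r(θ) = (cos θ, sin θ, 0)`. [folklore] -/
def frameR (θ : ℝ) : ℝ³ :=
  Real.cos θ • EuclideanSpace.single 0 1 + Real.sin θ • EuclideanSpace.single 1 1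

/-- The angular unit vector at angle `θ`: `e_θ(θ) = (−sin θ, cos θ, 0)`. [folklore] -/
def frameTheta (θ : ℝ) : ℝ³ :=
  -Real.sin θ • EuclideanSpace.single 0 1 + Real.cos θ • EuclideanSpace.single 1 1

/-- First component of `e_r(θ)`: `cos θ`. [folklore] -/
@[simp] theorem frameR_apply_zero (θ : ℝ) : frameR θ 0 = Real.cos θ := by simp [frameR]
/-- Second component of `e_r(θ)`: `sin θ`. [folklore] -/
@[simp] theorem frameR_apply_one (θ : ℝ) : frameR θ 1 = Real.sin θ := by simp [frameR]
/-- Third component of `e_r(θ)`: `0`. [folklore] -/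
@[simp] theorem frameR_apply_two (θ : ℝ) : frameR θ 2 = 0 := by simp [frameR]
/-- First component of `e_θ(θ)`: `−sin θ`. [folklore] -/
@[simp] theorem frameTheta_apply_zero (θ : ℝ) : frameTheta θ 0 = -Real.sin θ := by
  simp [frameTheta]
/-- Second component of `e_θ(θ)`: `cos θ`. [folklore] -/
@[simp] theorem frameTheta_apply_one (θ : ℝ) : frameTheta θ 1 = Real.cos θ := by
  simp [frameTheta]
/-- Third component of `e_θ(θ)`: `0`. [folklore] -/
@[simp] theorem frameTheta_apply_two (θ : ℝ) : frameTheta θ 2 = 0 := by simp [frameTheta]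

/-- `e_r(θ) = R_θ e₀`. [folklore] -/
theorem rotZ_single_zero (θ : ℝ) : rotZ θ (EuclideanSpace.single 0 1) = frameR θ := by
  ext i; fin_cases i <;> simp

/-- `e_θ(θ) = R_θ e₁`. [folklore] -/
theorem rotZ_single_one (θ : ℝ) : rotZ θ (EuclideanSpace.single 1 1) = frameTheta θ := by
  ext i; fin_cases i <;> simp

/-- `R_θ e₂ = e₂ = e_z`. [folklore] -/
theorem rotZ_single_two (θ : ℝ) : rotZ θ (EuclideanSpace.single 2 1) = eZ := by
  ext i; fin_cases i <;> simp [eZ]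

/-- The rotating orthonormal frame `(e_r(θ), e_θ(θ), e_z)`: the standard basis rotated by
`R_θ`. [folklore] -/
def frameBasis (θ : ℝ) : OrthonormalBasis (Fin 3) ℝ ℝ³ :=
  (EuclideanSpace.basisFun (Fin 3) ℝ).map (rotZLIE θ)

/-- The first frame vector is `e_r(θ)`. [folklore] -/
@[simp] theorem frameBasis_apply_zero (θ : ℝ) : frameBasis θ 0 = frameR θ := by
  simp only [frameBasis, OrthonormalBasis.map_apply, EuclideanSpace.basisFun_apply, rotZLIE_apply,
    rotZ_single_zero]
/-- The second frame vector is `e_θ(θ)`. [folklore] -/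
@[simp] theorem frameBasis_apply_one (θ : ℝ) : frameBasis θ 1 = frameTheta θ := by
  simp only [frameBasis, OrthonormalBasis.map_apply, EuclideanSpace.basisFun_apply, rotZLIE_apply,
    rotZ_single_one]
/-- The third frame vector is `e_z`. [folklore] -/
@[simp] theorem frameBasis_apply_two (θ : ℝ) : frameBasis θ 2 = eZ := by
  simp only [frameBasis, OrthonormalBasis.map_apply, EuclideanSpace.basisFun_apply, rotZLIE_apply,
    rotZ_single_two]

/-- `θ ↦ e_r(θ)` has velocity `e_θ(θ)`. [folklore] -/
theorem hasDerivAt_frameR (θ : ℝ) : HasDerivAt frameR (frameTheta θ) θ := by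
  unfold frameR frameTheta
  exact ((Real.hasDerivAt_cos θ).smul_const _).add ((Real.hasDerivAt_sin θ).smul_const _)

/-- `θ ↦ e_θ(θ)` has velocity `−e_r(θ)`. [folklore] -/
theorem hasDerivAt_frameTheta (θ : ℝ) : HasDerivAt frameTheta (-frameR θ) θ := by
  have h : HasDerivAt frameTheta (-Real.cos θ • EuclideanSpace.single 0 1 +
      -Real.sin θ • EuclideanSpace.single 1 1) θ := by
    unfold frameTheta
    exact ((Real.hasDerivAt_sin θ).neg.smul_const _).add ((Real.hasDerivAt_cos θ).smul_const _)
  refine h.congr_deriv ?_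
  ext i; fin_cases i <;> simp [frameR]

/-- `frameR` is smooth. [folklore] -/
theorem contDiff_frameR : ContDiff ℝ ∞ frameR := by
  unfold frameR
  exact (Real.contDiff_cos.smul contDiff_const).add (Real.contDiff_sin.smul contDiff_const)

/-- `frameTheta` is smooth. [folklore] -/
theorem contDiff_frameTheta : ContDiff ℝ ∞ frameTheta := by
  unfold frameTheta
  exact (Real.contDiff_sin.neg.smul contDiff_const).add (Real.contDiff_cos.smul contDiff_const)

/-- The frames at `θ = −π` and `θ = π` coincide. [folklore] -/
theorem frameR_neg_pi : frameR (-Real.pi) = frameR Real.pi := by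
  simp [frameR, Real.cos_neg, Real.sin_neg]

/-- The frames at `θ = −π` and `θ = π` coincide. [folklore] -/
theorem frameTheta_neg_pi : frameTheta (-Real.pi) = frameTheta Real.pi := by
  simp [frameTheta, Real.cos_neg, Real.sin_neg]

/-! ### Cylindrical coordinates -/

/-- Cylindrical coordinates `Φ(r, θ, z) = r e_r(θ) + z e_z = (r cos θ, r sin θ, z)` on the
parameter space `Fin 3 → ℝ` (`p 0 = r`, `p 1 = θ`, `p 2 = z`). [folklore] -/
def cylCoord (p : Fin 3 → ℝ) : ℝ³ :=
  p 0 • frameR (p 1) + p 2 • eZ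

/-- `Φ(r,θ,z)₀ = r cos θ`. [folklore] -/
@[simp] theorem cylCoord_apply_zero (p : Fin 3 → ℝ) : cylCoord p 0 = p 0 * Real.cos (p 1) := by
  simp [cylCoord, eZ]
/-- `Φ(r,θ,z)₁ = r sin θ`. [folklore] -/
@[simp] theorem cylCoord_apply_one (p : Fin 3 → ℝ) : cylCoord p 1 = p 0 * Real.sin (p 1) := by
  simp [cylCoord, eZ]
/-- `Φ(r,θ,z)₂ = z`. [folklore] -/
@[simp] theorem cylCoord_apply_two (p : Fin 3 → ℝ) : cylCoord p 2 = p 2 := by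
  simp [cylCoord, eZ]

/-- `r(Φ p) = p₀` for `p₀ ≥ 0`. [folklore] -/
theorem cylRadius_cylCoord {p : Fin 3 → ℝ} (hp : 0 ≤ p 0) : cylRadius (cylCoord p) = p 0 := by
  rw [cylRadius, cylCoord_apply_zero, cylCoord_apply_one]
  have : (p 0 * Real.cos (p 1)) ^ 2 + (p 0 * Real.sin (p 1)) ^ 2 = (p 0) ^ 2 := by
    linear_combination (p 0) ^ 2 * Real.cos_sq_add_sin_sq (p 1)
  rw [this, Real.sqrt_sq hp]

/-- `Φ p` lies in the open cylinder for `0 ≤ p₀ < 1`. [folklore] -/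
theorem cylCoord_mem_unitCylinder {p : Fin 3 → ℝ} (h0 : 0 ≤ p 0) (h1 : p 0 < 1) :
    cylCoord p ∈ unitCylinder := by
  rw [mem_unitCylinder, cylRadius_cylCoord h0]; exact h1

/-- `Φ p` lies on the wall for `p₀ = 1`. [folklore] -/
theorem cylCoord_mem_frontier {p : Fin 3 → ℝ} (h : p 0 = 1) :
    cylCoord p ∈ frontier (unitCylinder : Set ℝ³) := by
  rw [frontier_unitCylinder, mem_setOf_eq, cylRadius_cylCoord (by rw [h]; exact zero_le_one), h]

/-- `Φ p` lies in the closed cylinder for `0 ≤ p₀ ≤ 1`. [folklore] -/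
theorem cylCoord_mem_closure {p : Fin 3 → ℝ} (h0 : 0 ≤ p 0) (h1 : p 0 ≤ 1) :
    cylCoord p ∈ closure (unitCylinder : Set ℝ³) := by
  rcases h1.lt_or_eq with h | h
  · exact subset_closure (cylCoord_mem_unitCylinder h0 h)
  · exact frontier_subset_closure (cylCoord_mem_frontier h)

/-- On the wall side `p₀ > 0`, `e_r(Φ p) = e_r(θ)`. [folklore] -/
theorem eR_cylCoord {p : Fin 3 → ℝ} (h : 0 < p 0) : eR (cylCoord p) = frameR (p 1) := by
  have hr := cylRadius_cylCoord h.le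
  ext i
  fin_cases i <;> simp [eR, hr] <;> field_simp

/-- `Φ` is smooth. [folklore] -/
theorem contDiff_cylCoord : ContDiff ℝ ∞ cylCoord :=
  ((contDiff_apply ℝ ℝ 0).smul (contDiff_frameR.comp (contDiff_apply ℝ ℝ 1))).add
    ((contDiff_apply ℝ ℝ 2).smul contDiff_const)

/-- `Φ` is continuous. [folklore] -/
theorem continuous_cylCoord : Continuous cylCoord :=
  contDiff_cylCoord.continuous

/-- Axial translation in the parameters is axial translation in space. [folklore] -/
theorem cylCoord_add_axial (p : Fin 3 → ℝ) (L : ℝ) :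
    cylCoord (p + L • Pi.single 2 1) = cylCoord p + L • EuclideanSpace.single (2 : Fin 3) (1 : ℝ) := by
  ext i; fin_cases i <;> simp

/-! ### The parameter box -/

/-- Lower corner `(0, −π, 0)` of the parameter box of a period cell. [folklore] -/
def cylBoxLo : Fin 3 → ℝ := ![0, -Real.pi, 0]

/-- Upper corner `(1, π, L)` of the parameter box of a period cell. [folklore] -/
def cylBoxHi (L : ℝ) : Fin 3 → ℝ := ![1, Real.pi, L]

/-- Lower `r`-bound `0`. [folklore] -/
@[simp] theorem cylBoxLo_zero : cylBoxLo 0 = 0 := rfl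
/-- Lower `θ`-bound `−π`. [folklore] -/
@[simp] theorem cylBoxLo_one : cylBoxLo 1 = -Real.pi := rfl
/-- Lower `z`-bound `0`. [folklore] -/
@[simp] theorem cylBoxLo_two : cylBoxLo 2 = 0 := rfl
/-- Upper `r`-bound `1`. [folklore] -/
@[simp] theorem cylBoxHi_zero (L : ℝ) : cylBoxHi L 0 = 1 := rfl
/-- Upper `θ`-bound `π`. [folklore] -/
@[simp] theorem cylBoxHi_one (L : ℝ) : cylBoxHi L 1 = Real.pi := rfl
/-- Upper `z`-bound `L`. [folklore] -/
@[simp] theorem cylBoxHi_two (L : ℝ) : cylBoxHi L 2 = L := rfl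

/-- `cylBoxLo ≤ cylBoxHi L` for `L ≥ 0`. [folklore] -/
theorem cylBoxLo_le_cylBoxHi {L : ℝ} (hL : 0 ≤ L) : cylBoxLo ≤ cylBoxHi L := fun i => by
  have hπ : -Real.pi ≤ Real.pi := by linarith [Real.pi_pos]
  fin_cases i <;> simp [cylBoxLo, cylBoxHi, hπ, hL]

/-- The closed parameter box `[0,1] × [−π,π] × [0,L]`. [folklore] -/
abbrev cylBox (L : ℝ) : Set (Fin 3 → ℝ) := Icc cylBoxLo (cylBoxHi L)

/-- The open parameter box `(0,1) × (−π,π) × (0,L)`. [folklore] -/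
abbrev cylBoxOpen (L : ℝ) : Set (Fin 3 → ℝ) := Set.pi univ fun i => Ioo (cylBoxLo i) (cylBoxHi L i)

/-- Points of the closed box have `0 ≤ p₀ ≤ 1`. [folklore] -/
theorem radius_mem_of_mem_cylBox {L : ℝ} {p : Fin 3 → ℝ} (hp : p ∈ cylBox L) :
    0 ≤ p 0 ∧ p 0 ≤ 1 := ⟨by simpa using hp.1 0, by simpa using hp.2 0⟩

/-- Points of the open box have `0 < p₀ < 1`. [folklore] -/
theorem radius_mem_of_mem_cylBoxOpen {L : ℝ} {p : Fin 3 → ℝ} (hp : p ∈ cylBoxOpen L) :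
    0 < p 0 ∧ p 0 < 1 := by simpa using hp 0 (mem_univ _)

/-- The closed box is mapped into the closed cylinder. [folklore] -/
theorem cylCoord_mem_closure_of_mem_cylBox {L : ℝ} {p : Fin 3 → ℝ} (hp : p ∈ cylBox L) :
    cylCoord p ∈ closure (unitCylinder : Set ℝ³) :=
  cylCoord_mem_closure (radius_mem_of_mem_cylBox hp).1 (radius_mem_of_mem_cylBox hp).2

/-- The open box is mapped into the open cylinder. [folklore] -/
theorem cylCoord_mem_of_mem_cylBoxOpen {L : ℝ} {p : Fin 3 → ℝ} (hp : p ∈ cylBoxOpen L) :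
    cylCoord p ∈ unitCylinder :=
  cylCoord_mem_unitCylinder (radius_mem_of_mem_cylBoxOpen hp).1.le (radius_mem_of_mem_cylBoxOpen hp).2

/-- The open box has full measure in the closed box: a property holding on the open box holds
a.e. on the closed box. [folklore] -/
theorem ae_restrict_cylBox_of_forall {L : ℝ} {P : (Fin 3 → ℝ) → Prop}
    (h : ∀ p ∈ cylBoxOpen L, P p) : ∀ᵐ p ∂(volume.restrict (cylBox L)), P p := by
  have hae : cylBoxOpen L =ᵐ[volume] cylBox L := by
    rw [volume_pi]; exact Measure.univ_pi_Ioo_ae_eq_Icc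
  rw [← Measure.restrict_congr_set hae]
  exact (ae_restrict_mem (MeasurableSet.univ_pi fun _ => measurableSet_Ioo)).mono h

/-! ### Flux components and their partial derivatives -/

/-- The **flux components** of a vector field `G` in cylindrical coordinates:
`f₀ = r ⟪G∘Φ, e_r⟫`, `f₁ = ⟪G∘Φ, e_θ⟫`, `f₂ = r ⟪G∘Φ, e_z⟫` (so that
`∂_r f₀ + ∂_θ f₁ + ∂_z f₂ = r (div G)∘Φ`, `sum_fderiv_cylFlux`). [folklore] -/
def cylFlux (G : ℝ³ → ℝ³) : Fin 3 → (Fin 3 → ℝ) → ℝ :=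
  ![fun p => p 0 * ⟪G (cylCoord p), frameR (p 1)⟫,
    fun p => ⟪G (cylCoord p), frameTheta (p 1)⟫,
    fun p => p 0 * ⟪G (cylCoord p), eZ⟫]

/-- The radial flux component `f₀ = r ⟪G∘Φ, e_r⟫`. [folklore] -/
@[simp] theorem cylFlux_zero (G : ℝ³ → ℝ³) (p : Fin 3 → ℝ) :
    cylFlux G 0 p = p 0 * ⟪G (cylCoord p), frameR (p 1)⟫ := rfl
/-- The angular flux component `f₁ = ⟪G∘Φ, e_θ⟫`. [folklore] -/
@[simp] theorem cylFlux_one (G : ℝ³ → ℝ³) (p : Fin 3 → ℝ) :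
    cylFlux G 1 p = ⟪G (cylCoord p), frameTheta (p 1)⟫ := rfl
/-- The axial flux component `f₂ = r ⟪G∘Φ, e_z⟫`. [folklore] -/
@[simp] theorem cylFlux_two (G : ℝ³ → ℝ³) (p : Fin 3 → ℝ) :
    cylFlux G 2 p = p 0 * ⟪G (cylCoord p), eZ⟫ := rfl

/-- The flux components are continuous on the closed box when `G` is continuous on the closed
cylinder. [folklore] -/
theorem continuousOn_cylFlux {G : ℝ³ → ℝ³} (hG : ContinuousOn G (closure (unitCylinder : Set ℝ³)))
    (L : ℝ) (i : Fin 3) : ContinuousOn (cylFlux G i) (cylBox L) := by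
  have hGc : ContinuousOn (fun p => G (cylCoord p)) (cylBox L) :=
    hG.comp continuous_cylCoord.continuousOn fun p hp => cylCoord_mem_closure_of_mem_cylBox hp
  have h0 : Continuous fun p : Fin 3 → ℝ => p 0 := continuous_apply 0
  have h1 : Continuous fun p : Fin 3 → ℝ => p 1 := continuous_apply 1
  have c0 : ContinuousOn (cylFlux G 0) (cylBox L) :=
    h0.continuousOn.mul (hGc.inner (contDiff_frameR.continuous.comp h1).continuousOn)
  have c1 : ContinuousOn (cylFlux G 1) (cylBox L) :=
    hGc.inner (contDiff_frameTheta.continuous.comp h1).continuousOn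
  have c2 : ContinuousOn (cylFlux G 2) (cylBox L) := h0.continuousOn.mul (hGc.inner continuousOn_const)
  fin_cases i
  exacts [c0, c1, c2]

section Deriv

variable {G : ℝ³ → ℝ³} {G' : ℝ³ →L[ℝ] ℝ³} {p : Fin 3 → ℝ}

/-- The flux components are differentiable where `G ∘ Φ` is. [folklore] -/
theorem differentiableAt_cylFlux (hG : DifferentiableAt ℝ G (cylCoord p)) (i : Fin 3) :
    DifferentiableAt ℝ (cylFlux G i) p := by
  have hc : DifferentiableAt ℝ cylCoord p := (contDiff_cylCoord.differentiable (by simp)) p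
  have hGc : DifferentiableAt ℝ (fun q => G (cylCoord q)) p := hG.comp p hc
  have h0 : DifferentiableAt ℝ (fun q : Fin 3 → ℝ => q 0) p := differentiableAt_apply 0 p
  have h1 : DifferentiableAt ℝ (fun q : Fin 3 → ℝ => q 1) p := differentiableAt_apply 1 p
  have hr : DifferentiableAt ℝ (fun q : Fin 3 → ℝ => frameR (q 1)) p :=
    ((contDiff_frameR.differentiable (by simp)) _).comp p h1
  have ht : DifferentiableAt ℝ (fun q : Fin 3 → ℝ => frameTheta (q 1)) p :=
    ((contDiff_frameTheta.differentiable (by simp)) _).comp p h1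
  have d0 : DifferentiableAt ℝ (cylFlux G 0) p := h0.mul (hGc.inner ℝ hr)
  have d1 : DifferentiableAt ℝ (cylFlux G 1) p := hGc.inner ℝ ht
  have d2 : DifferentiableAt ℝ (cylFlux G 2) p := h0.mul (hGc.inner ℝ (differentiableAt_const _))
  fin_cases i
  exacts [d0, d1, d2]

/-- Moving in the `r`-parameter moves `Φ` along `e_r`. [folklore] -/
theorem cylCoord_add_smul_single_zero (p : Fin 3 → ℝ) (s : ℝ) :
    cylCoord (p + s • Pi.single 0 1) = cylCoord p + s • frameR (p 1) := by
  simp only [cylCoord, Pi.add_apply, Pi.smul_apply, Pi.single_apply]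
  simp [add_smul]
  abel

/-- Moving in the `θ`-parameter rotates the frame. [folklore] -/
theorem cylCoord_add_smul_single_one (p : Fin 3 → ℝ) (s : ℝ) :
    cylCoord (p + s • Pi.single 1 1) = p 0 • frameR (p 1 + s) + p 2 • eZ := by
  simp only [cylCoord, Pi.add_apply, Pi.smul_apply, Pi.single_apply]
  simp

/-- Moving in the `z`-parameter moves `Φ` along `e_z`. [folklore] -/
theorem cylCoord_add_smul_single_two (p : Fin 3 → ℝ) (s : ℝ) :
    cylCoord (p + s • Pi.single 2 1) = cylCoord p + s • eZ := by
  simp only [cylCoord, Pi.add_apply, Pi.smul_apply, Pi.single_apply]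
  simp [add_smul]
  abel

/-- `∂_r f₀ = ⟪G, e_r⟫ + r ⟪G' e_r, e_r⟫` along the `r`-line. [folklore] -/
theorem hasDerivAt_cylFlux_zero_line (hG : HasFDerivAt G G' (cylCoord p)) :
    HasDerivAt (fun s : ℝ => cylFlux G 0 (p + s • Pi.single 0 1))
      (⟪G (cylCoord p), frameR (p 1)⟫ + p 0 * ⟪G' (frameR (p 1)), frameR (p 1)⟫) (0 : ℝ) := by
  have hfun : (fun s : ℝ => cylFlux G 0 (p + s • Pi.single 0 1)) =
      fun s : ℝ => (p 0 + s) * ⟪G (cylCoord p + s • frameR (p 1)), frameR (p 1)⟫ := by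
    funext s
    rw [cylFlux_zero, cylCoord_add_smul_single_zero]
    simp
  rw [hfun]
  have hγ : HasDerivAt (fun s : ℝ => cylCoord p + s • frameR (p 1)) (frameR (p 1)) 0 := by
    simpa using ((hasDerivAt_id (0 : ℝ)).smul_const (frameR (p 1))).const_add (cylCoord p)
  have hGγ : HasDerivAt (fun s : ℝ => G (cylCoord p + s • frameR (p 1))) (G' (frameR (p 1))) 0 :=
    hG.comp_hasDerivAt_of_eq 0 hγ (by simp)
  have hin := hGγ.inner ℝ (hasDerivAt_const (0 : ℝ) (frameR (p 1)))
  have hmul := ((hasDerivAt_id (0 : ℝ)).const_add (p 0)).mul hin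
  refine hmul.congr_deriv ?_
  simp

/-- `∂_θ f₁ = r ⟪G' e_θ, e_θ⟫ − ⟪G, e_r⟫` along the `θ`-line. [folklore] -/
theorem hasDerivAt_cylFlux_one_line (hG : HasFDerivAt G G' (cylCoord p)) :
    HasDerivAt (fun s : ℝ => cylFlux G 1 (p + s • Pi.single 1 1))
      (p 0 * ⟪G' (frameTheta (p 1)), frameTheta (p 1)⟫ - ⟪G (cylCoord p), frameR (p 1)⟫) (0 : ℝ) := by
  have hfun : (fun s : ℝ => cylFlux G 1 (p + s • Pi.single 1 1)) =
      fun s : ℝ => ⟪G (p 0 • frameR (p 1 + s) + p 2 • eZ), frameTheta (p 1 + s)⟫ := by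
    funext s
    rw [cylFlux_one, cylCoord_add_smul_single_one]
    simp
  rw [hfun]
  have hγ : HasDerivAt (fun s : ℝ => p 0 • frameR (p 1 + s) + p 2 • eZ)
      (p 0 • frameTheta (p 1)) 0 := by
    have h1 : HasDerivAt (fun s : ℝ => frameR (p 1 + s)) (frameTheta (p 1)) 0 := by
      have := (hasDerivAt_frameR (p 1)).scomp_of_eq (0 : ℝ)
        ((hasDerivAt_id' (0 : ℝ)).const_add (p 1)) (by simp)
      simpa [Function.comp_def] using this
    simpa using (h1.const_smul (p 0)).add_const (p 2 • eZ)
  have hGγ : HasDerivAt (fun s : ℝ => G (p 0 • frameR (p 1 + s) + p 2 • eZ))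
      (G' (p 0 • frameTheta (p 1))) 0 :=
    hG.comp_hasDerivAt_of_eq 0 hγ (by simp [cylCoord])
  have hθ : HasDerivAt (fun s : ℝ => frameTheta (p 1 + s)) (-frameR (p 1)) 0 := by
    have := (hasDerivAt_frameTheta (p 1)).scomp_of_eq (0 : ℝ)
      ((hasDerivAt_id' (0 : ℝ)).const_add (p 1)) (by simp)
    simpa [Function.comp_def] using this
  have hin := hGγ.inner ℝ hθ
  refine hin.congr_deriv ?_
  simp only [map_smul, inner_neg_right, inner_smul_left, add_zero, RCLike.conj_to_real]
  simp [cylCoord]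
  ring

/-- `∂_z f₂ = r ⟪G' e_z, e_z⟫` along the `z`-line. [folklore] -/
theorem hasDerivAt_cylFlux_two_line (hG : HasFDerivAt G G' (cylCoord p)) :
    HasDerivAt (fun s : ℝ => cylFlux G 2 (p + s • Pi.single 2 1)) (p 0 * ⟪G' eZ, eZ⟫) (0 : ℝ) := by
  have hfun : (fun s : ℝ => cylFlux G 2 (p + s • Pi.single 2 1)) =
      fun s : ℝ => p 0 * ⟪G (cylCoord p + s • eZ), eZ⟫ := by
    funext s
    rw [cylFlux_two, cylCoord_add_smul_single_two]
    simp
  rw [hfun]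
  have hγ : HasDerivAt (fun s : ℝ => cylCoord p + s • eZ) eZ 0 := by
    simpa using ((hasDerivAt_id (0 : ℝ)).smul_const eZ).const_add (cylCoord p)
  have hGγ : HasDerivAt (fun s : ℝ => G (cylCoord p + s • eZ)) (G' eZ) 0 :=
    hG.comp_hasDerivAt_of_eq 0 hγ (by simp)
  have hin := hGγ.inner ℝ (hasDerivAt_const (0 : ℝ) eZ)
  have hmul := hin.const_mul (p 0)
  refine hmul.congr_deriv ?_
  simp

/-- A partial derivative of a differentiable function is the derivative along the coordinate
line. [folklore] -/
theorem fderiv_apply_single_eq_of_hasDerivAt_line {f : (Fin 3 → ℝ) → ℝ} {i : Fin 3} {v : ℝ}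
    (hd : DifferentiableAt ℝ f p)
    (hline : HasDerivAt (fun s : ℝ => f (p + s • Pi.single i 1)) v (0 : ℝ)) :
    fderiv ℝ f p (Pi.single i 1) = v := by
  have hγ : HasDerivAt (fun s : ℝ => p + s • Pi.single i (1 : ℝ)) (Pi.single i 1) (0 : ℝ) := by
    simpa using ((hasDerivAt_id (0 : ℝ)).smul_const (Pi.single i (1 : ℝ))).const_add p
  have h1 : HasDerivAt (fun s : ℝ => f (p + s • Pi.single i 1)) (fderiv ℝ f p (Pi.single i 1))
      (0 : ℝ) :=
    hd.hasFDerivAt.comp_hasDerivAt_of_eq (0 : ℝ) hγ (by simp)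
  exact h1.unique hline

/-- **The divergence in cylindrical coordinates**: `∂_r f₀ + ∂_θ f₁ + ∂_z f₂ = r (div G)(Φ p)`
for the flux components `f = cylFlux G`, at every parameter point where `G` is differentiable
at `Φ p` (the divergence is the trace of `DG` in the rotating orthonormal frame
`(e_r, e_θ, e_z)`). [folklore] -/
theorem sum_fderiv_cylFlux (hG : HasFDerivAt G G' (cylCoord p)) :
    ∑ i, fderiv ℝ (cylFlux G i) p (Pi.single i 1) = p 0 * VectorCalculus.divergence G (cylCoord p) := by
  have hd := differentiableAt_cylFlux hG.differentiableAt
  rw [Fin.sum_univ_three,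
    fderiv_apply_single_eq_of_hasDerivAt_line (hd 0) (hasDerivAt_cylFlux_zero_line hG),
    fderiv_apply_single_eq_of_hasDerivAt_line (hd 1) (hasDerivAt_cylFlux_one_line hG),
    fderiv_apply_single_eq_of_hasDerivAt_line (hd 2) (hasDerivAt_cylFlux_two_line hG),
    divergence_eq_sum_inner_fderiv (frameBasis (p 1)), Fin.sum_univ_three, hG.fderiv]
  simp only [frameBasis_apply_zero, frameBasis_apply_one, frameBasis_apply_two,
    real_inner_comm (frameR (p 1)), real_inner_comm (frameTheta (p 1)), real_inner_comm eZ]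
  ring

end Deriv

/-! ### The flux identity -/

/-- On the front and back `r`-faces the radial flux component vanishes: `f₀ = 0` at `r = 0`,
and `f₀ = ⟪G, e_r⟫ = 0` at `r = 1` for a field tangential on the wall. [folklore] -/
theorem cylFlux_zero_rface {G : ℝ³ → ℝ³}
    (hslip : ∀ x ∈ frontier (unitCylinder : Set ℝ³), ⟪G x, eR x⟫ = 0) (y : Fin 2 → ℝ) :
    cylFlux G 0 (Fin.insertNth 0 (1 : ℝ) y) = 0 ∧ cylFlux G 0 (Fin.insertNth 0 (0 : ℝ) y) = 0 := by
  constructor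
  · set q : Fin 3 → ℝ := Fin.insertNth 0 (1 : ℝ) y with hq
    have hq0 : q 0 = 1 := by simp [hq]
    have hx : cylCoord q ∈ frontier (unitCylinder : Set ℝ³) := cylCoord_mem_frontier hq0
    have he : eR (cylCoord q) = frameR (q 1) := eR_cylCoord (by rw [hq0]; exact one_pos)
    rw [cylFlux_zero, ← he, hslip _ hx, mul_zero]
  · simp

/-- The `θ`-faces `θ = π` and `θ = −π` carry the same angular flux component. [folklore] -/
theorem cylFlux_one_thetaface (G : ℝ³ → ℝ³) (y : Fin 2 → ℝ) :
    cylFlux G 1 (Fin.insertNth 1 Real.pi y) = cylFlux G 1 (Fin.insertNth 1 (-Real.pi) y) := by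
  have e0 : (1 : Fin 3).succAbove 0 = 0 := by decide
  have e1 : (1 : Fin 3).succAbove 1 = 2 := by decide
  have h0 : ∀ c : ℝ, (Fin.insertNth 1 c y : Fin 3 → ℝ) 0 = y 0 := fun c => by
    have := Fin.insertNth_apply_succAbove (α := fun _ => ℝ) 1 c y 0; rwa [e0] at this
  have h2 : ∀ c : ℝ, (Fin.insertNth 1 c y : Fin 3 → ℝ) 2 = y 1 := fun c => by
    have := Fin.insertNth_apply_succAbove (α := fun _ => ℝ) 1 c y 1; rwa [e1] at this
  have h1 : ∀ c : ℝ, (Fin.insertNth 1 c y : Fin 3 → ℝ) 1 = c := fun c => by simp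
  simp only [cylFlux_one, cylCoord, h0, h1, h2, frameR_neg_pi, frameTheta_neg_pi]

/-- The `z`-faces `z = L` and `z = 0` carry the same axial flux component for an `L`-periodic
field. [folklore] -/
theorem cylFlux_two_zface {G : ℝ³ → ℝ³} {L : ℝ} (hper : IsAxiallyPeriodic L G) (y : Fin 2 → ℝ) :
    cylFlux G 2 (Fin.insertNth 2 L y) = cylFlux G 2 (Fin.insertNth 2 (0 : ℝ) y) := by
  have e0 : (2 : Fin 3).succAbove 0 = 0 := by decide
  have e1 : (2 : Fin 3).succAbove 1 = 1 := by decide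
  have h0 : ∀ c : ℝ, (Fin.insertNth 2 c y : Fin 3 → ℝ) 0 = y 0 := fun c => by
    have := Fin.insertNth_apply_succAbove (α := fun _ => ℝ) 2 c y 0; rwa [e0] at this
  have h1 : ∀ c : ℝ, (Fin.insertNth 2 c y : Fin 3 → ℝ) 1 = y 1 := fun c => by
    have := Fin.insertNth_apply_succAbove (α := fun _ => ℝ) 2 c y 1; rwa [e1] at this
  have h2 : ∀ c : ℝ, (Fin.insertNth 2 c y : Fin 3 → ℝ) 2 = c := fun c => by simp
  have hshift : cylCoord (Fin.insertNth 2 L y) =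
      cylCoord (Fin.insertNth 2 (0 : ℝ) y) + L • EuclideanSpace.single (2 : Fin 3) (1 : ℝ) := by
    simp only [cylCoord, h0, h1, h2, zero_smul, add_zero, eZ]
  simp only [cylFlux_two, h0, hshift, hper _]

/-- **The flux of a tangential periodic `C¹` field out of a period cell vanishes**, in
cylindrical coordinates: for `G` of class `C¹` on the closed cylinder `{r ≤ 1}`, `L`-periodic
in `z` (`L ≥ 0`) and tangential on the wall `{r = 1}`,
`∫_{[0,1]×[−π,π]×[0,L]} r · (div G)(Φ(r,θ,z)) = 0`.
Proof: Mathlib's divergence theorem on the box for the flux components `cylFlux G`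
(continuous on the closed box, differentiable on the open box, where their divergence is
`r (div G)∘Φ` by `sum_fderiv_cylFlux` — a continuous, hence integrable, function on the closed
box), and all face terms vanish (`cylFlux_zero_rface`, `cylFlux_one_thetaface`,
`cylFlux_two_zface`). This is the integration-by-parts input of the `L²` energy method for the
Euler equations in the periodic cylinder (Kato–Lai 1984, p. 23). [folklore] -/
theorem setIntegral_mul_divergence_cylCoord_eq_zero {G : ℝ³ → ℝ³} {L : ℝ} (hL : 0 ≤ L)
    (hG : ContDiffOn ℝ 1 G (closure (unitCylinder : Set ℝ³))) (hper : IsAxiallyPeriodic L G)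
    (hslip : ∀ x ∈ frontier (unitCylinder : Set ℝ³), ⟪G x, eR x⟫ = 0) :
    ∫ p in cylBox L, p 0 * VectorCalculus.divergence G (cylCoord p) = 0 := by
  set K : Set ℝ³ := closure (unitCylinder : Set ℝ³) with hK
  have hKu : UniqueDiffOn ℝ K :=
    uniqueDiffOn_convex convex_unitCylinder.closure
      ⟨0, interior_mono subset_closure (by
        rw [unitCylinder.isOpen.interior_eq]; exact zero_mem_unitCylinder)⟩
  -- `G` is differentiable at the image of the open box, with `fderiv = fderivWithin K`
  have hKn : ∀ p ∈ cylBoxOpen L, K ∈ 𝓝 (cylCoord p) := fun p hp =>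
    mem_of_superset (unitCylinder.isOpen.mem_nhds (cylCoord_mem_of_mem_cylBoxOpen hp)) subset_closure
  have hGd : ∀ p ∈ cylBoxOpen L, HasFDerivAt G (fderivWithin ℝ G K (cylCoord p)) (cylCoord p) :=
    fun p hp => by
    have hdw : DifferentiableWithinAt ℝ G K (cylCoord p) :=
      hG.differentiableOn one_ne_zero _ (subset_closure (cylCoord_mem_of_mem_cylBoxOpen hp))
    have hd : DifferentiableAt ℝ G (cylCoord p) := hdw.differentiableAt (hKn p hp)
    rw [fderivWithin_of_mem_nhds (hKn p hp)]
    exact hd.hasFDerivAt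
  -- the continuous representative of the divergence on the closed box
  set g : (Fin 3 → ℝ) → ℝ := fun p =>
    p 0 * ∑ i, ⟪EuclideanSpace.basisFun (Fin 3) ℝ i,
      fderivWithin ℝ G K (cylCoord p) (EuclideanSpace.basisFun (Fin 3) ℝ i)⟫ with hg
  have hgc : ContinuousOn g (cylBox L) := by
    have hD : ContinuousOn (fun p => fderivWithin ℝ G K (cylCoord p)) (cylBox L) :=
      (hG.continuousOn_fderivWithin hKu le_rfl).comp continuous_cylCoord.continuousOn
        fun p hp => cylCoord_mem_closure_of_mem_cylBox hp
    refine (continuous_apply 0).continuousOn.mul (continuousOn_finsetSum _ fun i _ => ?_)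
    exact continuousOn_const.inner (hD.clm_apply continuousOn_const)
  have hgi : IntegrableOn g (cylBox L) := hgc.integrableOn_compact isCompact_Icc
  have heq : ∀ p ∈ cylBoxOpen L,
      ∑ i, fderiv ℝ (cylFlux G i) p (Pi.single i 1) = g p ∧
        p 0 * VectorCalculus.divergence G (cylCoord p) = g p := fun p hp => by
    have hs := sum_fderiv_cylFlux (hGd p hp)
    have hdiv : VectorCalculus.divergence G (cylCoord p) = ∑ i, ⟪EuclideanSpace.basisFun (Fin 3) ℝ i,
        fderivWithin ℝ G K (cylCoord p) (EuclideanSpace.basisFun (Fin 3) ℝ i)⟫ := by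
      rw [divergence_eq_sum_inner_fderiv (EuclideanSpace.basisFun (Fin 3) ℝ), (hGd p hp).fderiv]
    exact ⟨by rw [hs, hg, hdiv], by rw [hg, hdiv]⟩
  have hae1 : ∀ᵐ p ∂(volume.restrict (cylBox L)),
      (fun p => ∑ i, fderiv ℝ (cylFlux G i) p (Pi.single i 1)) p = g p :=
    ae_restrict_cylBox_of_forall fun p hp => (heq p hp).1
  have hae2 : ∀ᵐ p ∂(volume.restrict (cylBox L)),
      (fun p => p 0 * VectorCalculus.divergence G (cylCoord p)) p = g p :=
    ae_restrict_cylBox_of_forall fun p hp => (heq p hp).2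
  -- the divergence theorem on the box
  have hDT := integral_divergence_of_hasFDerivAt_off_countable' cylBoxLo (cylBoxHi L)
    (cylBoxLo_le_cylBoxHi hL) (cylFlux G) (fun i p => fderiv ℝ (cylFlux G i) p) ∅ countable_empty
    (fun i => continuousOn_cylFlux hG.continuousOn L i)
    (fun p hp i => (differentiableAt_cylFlux (hGd p hp.1).differentiableAt i).hasFDerivAt)
    (hgi.congr_fun_ae (ae_restrict_cylBox_of_forall fun p hp => ((heq p hp).1).symm))
  -- all face terms vanish
  have hfaces : ∑ i : Fin 3,
      ((∫ y in Icc (cylBoxLo ∘ Fin.succAbove i) (cylBoxHi L ∘ Fin.succAbove i),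
          cylFlux G i (Fin.insertNth i (cylBoxHi L i) y)) -
        ∫ y in Icc (cylBoxLo ∘ Fin.succAbove i) (cylBoxHi L ∘ Fin.succAbove i),
          cylFlux G i (Fin.insertNth i (cylBoxLo i) y)) = 0 := by
    rw [Fin.sum_univ_three]
    simp only [cylBoxHi_zero, cylBoxLo_zero, cylBoxHi_one, cylBoxLo_one, cylBoxHi_two, cylBoxLo_two,
      (cylFlux_zero_rface hslip _).1, (cylFlux_zero_rface hslip _).2, cylFlux_one_thetaface,
      cylFlux_two_zface hper, integral_zero, sub_self, add_zero]
  rw [integral_congr_ae hae2, ← integral_congr_ae hae1, hDT, hfaces]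

end Literature.Analysis.FluidPDE
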